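import Literature.IUT.HodgeArakelov.BadPrimeGaussianMonoidsGenuineRecordRootsOfTranslates
import Literature.IUT.HodgeArakelov.EtaleThetaDataOfSettingCyclotomeTower

/-!
# [IUTchII] Cor 3.5 (ii) at the genuine `θ_env` data: `horbit` / `horb` / `hroots` FROM THE [EtTh] INVERSION DATUM `ι` (with its
# theta companion) and the cyclotome tower — (R1) and `hker` of `…OrbitOfTranslates` / `…RootsOfTranslates` DISCHARGED

S. Mochizuki, *Inter-universal Teichmüller theory II*, kurims Dec-2020 manuscript, Rmk 1.4.1 (ii) p. 28 (the pointed inversion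
automorphism `ι_X̲̲`), Rmk 2.1.1 (i) p. 65 («`ι` … acts by `−1` on `Z`»), Prop 2.2 (ii) p. 66, Prop 3.1 (i) p. 87, Cor 3.5 (ii) p. 95
[cite: Mochizuki2012, Prop 2.2 (ii) p.66]; [EtTh] Def 2.5 (i) p. 39, Thm 1.6 (ii) p. 24 (theta companions), Def 2.13 / Cor 2.19 (ii)
p. 64 (the cyclotome tower `μ_N ≅ (l·Δ_Θ) ⊗ ℤ/Nℤ`) — refereed. Claim key `Mochizuki2012` DISPUTED (D-0012). PROOF-ONLY companion
(abc-iut cell, layer L6, seat abc-iut-w4-d004 gen 4; node **IUTchII:Cor3.5(ii)**; file 4 of row «COR35ii-HORB-GENUINE»). NO definition,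
NO `Prop` fact, NO instance; consumed BY NAME: abc-iut-w5-d072's `inversionAlpha` / `thetaCompanion_phi` /
`mem_lDeltaTheta_iff_thetaCompanion` / `toLZ_inversionAlpha_generator` / `inversionTransport` (the (R1) pair FROM the [EtTh] datum,
exactly as in `prop22_ii'_model_of_inversion`), abc-iut-w4-d041's `hfix_of_cyclotomeTower` (`hker` from `IsEtThOrigin` + a
`CyclotomeTower`), and files 1–3 of this row.

WHAT IS PROVED (all at the genuine `θ_env` data `EtaleLevels.thetaEnvData C …` / its Prop 3.1 record with ANY inversion family `iota`
whose `i₀`-th member is the limit action of THE inversion: `iota i₀ = pairRhoLim C (inversionAlpha C ι hι) c.thetaIso …`):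
* `EtaleLevels.horbit_thetaEnvData_inversion` — the raw [IUTchII] Prop 2.2 (ii) `μ_{2l}`-orbit clause in the limit;
* `EtaleLevels.horb_toRecord_inversion` — the Cor 3.5 (ii) junction input `horb`;
* `EtaleLevels.hroots_toRecord_inversion` — print's root condition at the `∞`-level.
INPUTS, all print-shaped: the inversion `ι ∈ Aut_top(Π^tp_X)` with `ι(Π^tp_{X̲̲}) = Π^tp_{X̲̲}` ([EtTh] Def 2.5 (i)), a theta companion
`c` ([EtTh] Thm 1.6 (ii)), the `ℤ`-reversal `toZ (ι γ) = (toZ γ)⁻¹` at a `toLZ`-generator ([IUTchII] Rmk 2.1.1 (i)); the class-level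
[EtTh] Prop 1.4 statements (R2) `hsign`, `hroot` (for `inversionTransport`), (R3) `hfree` — abc-iut-w4-d010's residual D-G-w4d010-2d
verbatim (deeper discharges: `ThetaEvaluationSettingModelAssembly2`); `IsEtThOrigin` + a `CyclotomeTower l Es` (for `hker`); bijective
coefficients `c` and `μ ⊆ O` (for `htors`). HONEST FRAMING: composition of landed theorems; nothing disputed is asserted; no side is
taken on [IUTchIII] Cor 3.12; typed ≠ proved ≠ endorsed.
-/

noncomputable section

namespace Literature.IUT.HodgeArakelov

namespace EtaleLevels

open Literature.AnabelianGeometry.EtaleTheta CohomologySystemOfContH1 EtaleThetaDataOfSetting TemperedThetaMonoids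
  BadPrimeGaussianMonoids

variable {p : ℕ} [Fact p.Prime] {D : Literature.AnabelianGeometry.EtaleTheta.ThetaSetting p}
  {E : D.EtaleThetaData} {l : ℕ} (C : E.DoubleUnderline l) (hC : D.Compat) (hS : D.Sec2Hyps)
  (hl : l.Prime) (hp2 : p ≠ 2) (hpl : p ≠ l) (hζ : ∃ ζ : D.K, IsPrimitiveRoot ζ (4 * l))
  (mods : ∀ M : ℕ+, D.CyclotomeMod l M)
  (f : contCocycles D.toTheta D.DeltaTheta C.GtpYdduu) (hf : f ∈ C.rootCocycles hC)
  (hmods : ∀ (M M' : ℕ+) (h : (M : ℕ) ∣ (M' : ℕ)) (x : D.lDeltaTheta l),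
    MuN.red p M M' h ((mods M').red x) = (mods M).red x)
  (h15 : Literature.AnabelianGeometry.EtaleTheta.ThetaSetting.Prop15iii E hC) (L : C.CuspLabels)
  (hZ : ∀ M : ℕ+, Nonempty (ModelCyclotomes.lDeltaQuot (C.rigidData (mods M) hC hS h15 L) ≃*
    Literature.IUT.HodgeTheaters.ZHat))
  (hcharY : EtaleThetaDataOfSetting.PiYddCharacteristic C)
  (hlim : Function.Bijective (rigidLimHom C hC hS hl hp2 hpl hζ mods f hf hmods h15 L hZ))
  [(EtaleThetaDataOfSetting.PiYdd C).Normal]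
  -- `hker` from the cyclotome tower ([EtTh] Cor 2.19 (ii)) under the freeness guard
  (hO : D.IsEtThOrigin) {Es : Set ℕ+} (τc : D.CyclotomeTower l Es)
  -- (R1) the [EtTh] inversion datum: `ι`, `ι(Π^tp_{X̲̲}) = Π^tp_{X̲̲}`, a theta companion, the `ℤ`-reversal at a generator
  (ι : D.PiTemp ≃ₜ* D.PiTemp) (hι : C.Huu.map ι.toMulEquiv.toMonoidHom = C.Huu) (cι : ThetaSetting.ThetaCompanion ι)
  (γ ε : Pi C) (hγ : C.toLZ γ = Multiplicative.ofAdd 1) (hε₁ : (ε : D.PiTemp) ∈ D.GtpY)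
  (hε₂ : (ε : D.PiTemp) ∉ D.GtpYdd) (hZι : D.toZ (ι (γ : D.PiTemp)) = (D.toZ (γ : D.PiTemp))⁻¹)

include hO τc hγ hε₁ hε₂ hZι

/-- **`horbit` AT THE GENUINE `θ_env` DATA FROM THE [EtTh] INVERSION DATUM** ([IUTchII] Prop 2.2 (ii) p. 66 / Prop 3.1 (i) p. 87):
for the limit action `pairRhoLim C (ι|Π^tp_{X̲̲}) c.thetaIso …` of the inversion `ι` with theta companion `c`, any two `ι`-invariants
up to torsion of the image of `θ(Π^tp_{X̲̲})` in `lim_J H¹(Π^tp_{Ÿ̲̲} ∩ J, l·Δ_Θ)` differ by a torsion class — file 1's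
`horbit_thetaEnvData_pairRhoLim_of_fixed` at the pair `(inversionAlpha C ι hι, c.thetaIso)` (abc-iut-w5-d072) with `hfix` from
abc-iut-w4-d041's `hfix_of_cyclotomeTower`. Inputs beyond the datum: (R2) `hsign`/`hroot`, (R3) `hfree`.
[cite: Mochizuki2012, Prop 2.2 (ii) p.66] -/
theorem horbit_thetaEnvData_inversion
    (hsign : ∃ κ : ContH1 (phi C) (D.lDeltaTheta l) (PiYdd C ⊓ ⊤), κ ^ 2 = 1 ∧
      ContH1.conj (phi C) (D.lDeltaTheta l) ε (rootLiftClass C) = rootLiftClass C * κ)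
    (hroot : ∃ τ₀ : Pi C, (τ₀ : D.PiTemp) ∈ D.GtpY ∧
      inversionTransport C ι hι cι hcharY (rootLiftClass C) = ContH1.conj (phi C) (D.lDeltaTheta l) τ₀ (rootLiftClass C))
    (hfree : ∀ m n : ℤ, IsOfFinAddOrder
      ((h1Top C).symm (Additive.ofMul (ContH1.conj (phi C) (D.lDeltaTheta l) (γ ^ m) (rootLiftClass C))) -
        (h1Top C).symm (Additive.ofMul (ContH1.conj (phi C) (D.lDeltaTheta l) (γ ^ n) (rootLiftClass C)))) →
      m = n) :
    ∀ x ∈ (thetaEnvData C hC hS hl hp2 hpl hζ mods f hf hmods h15 L hZ hcharY hlim).thetaIotaLim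
        (pairRhoLim C (inversionAlpha C ι hι) cι.thetaIso (thetaCompanion_phi C ι hι cι)
          (mem_lDeltaTheta_iff_thetaCompanion ι cι l) (mem_PiYdd_iff_of_piYddCharacteristic C hcharY _)),
      ∀ x' ∈ (thetaEnvData C hC hS hl hp2 hpl hζ mods f hf hmods h15 L hZ hcharY hlim).thetaIotaLim
        (pairRhoLim C (inversionAlpha C ι hι) cι.thetaIso (thetaCompanion_phi C ι hι cι)
          (mem_lDeltaTheta_iff_thetaCompanion ι cι l) (mem_PiYdd_iff_of_piYddCharacteristic C hcharY _)),
        IsOfFinAddOrder (x' - x) :=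
  horbit_thetaEnvData_pairRhoLim_of_fixed C hC hS hl hp2 hpl hζ mods f hf hmods h15 L hZ hcharY hlim (inversionAlpha C ι hι)
    cι.thetaIso (thetaCompanion_phi C ι hι cι) (mem_lDeltaTheta_iff_thetaCompanion ι cι l)
    (mem_PiYdd_iff_of_piYddCharacteristic C hcharY _) γ ε hγ hε₁ hε₂ (toLZ_inversionAlpha_generator C ι hι γ hγ hZι)
    hsign hroot hfree (hfix_of_cyclotomeTower C hO τc)

section AnyConstants

variable {Iota : Type}
  (iota : Iota → ((thetaEnvData C hC hS hl hp2 hpl hζ mods f hf hmods h15 L hZ hcharY hlim).D.coh.lim ≃+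
    (thetaEnvData C hC hS hl hp2 hpl hζ mods f hf hmods h15 L hZ hcharY hlim).D.coh.lim))
  {A : Type} [CommGroup A] [MulDistribMulAction (Pi C) A] [TopologicalSpace A] [RootableBy A ℕ]
  (c : CyclotomeCoefficients (phi C) (D.lDeltaTheta l) A)
  (hA : ∀ b : A, IsOpen (MulAction.stabilizer (Pi C) b : Set (Pi C)))
  (hfi : ∀ b : A, (MulAction.stabilizer (Pi C) b).FiniteIndex)
  (O : Submonoid A)

/-- **The Cor 3.5 (ii) junction input `horb` AT THE GENUINE RECORD FROM THE [EtTh] INVERSION DATUM** ([IUTchII] Cor 2.8 (i) p. 82 /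
Prop 3.1 (i) p. 87): for ANY inversion family `iota` with `iota i₀ =` the limit action of `ι` (with its theta companion),
`θ^{i₀}_env(𝕄_*)` is ONE `M^×_TM`-orbit — file 1's `horb_toRecord_pairRhoLim` with (R1) := the [EtTh] datum and `hker` := the
cyclotome tower. Inputs beyond the datum: (R2)(R3), bijective `c`, `μ ⊆ O`. [cite: Mochizuki2012, Cor 2.8 (i) p.82] -/
theorem horb_toRecord_inversion (hc : Function.Bijective c.hom)
    (hOtors : ∀ a : A, IsOfFinOrder a → a ∈ O ∧ a⁻¹ ∈ O)
    (hsign : ∃ κ : ContH1 (phi C) (D.lDeltaTheta l) (PiYdd C ⊓ ⊤), κ ^ 2 = 1 ∧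
      ContH1.conj (phi C) (D.lDeltaTheta l) ε (rootLiftClass C) = rootLiftClass C * κ)
    (hroot : ∃ τ₀ : Pi C, (τ₀ : D.PiTemp) ∈ D.GtpY ∧
      inversionTransport C ι hι cι hcharY (rootLiftClass C) = ContH1.conj (phi C) (D.lDeltaTheta l) τ₀ (rootLiftClass C))
    (hfree : ∀ m n : ℤ, IsOfFinAddOrder
      ((h1Top C).symm (Additive.ofMul (ContH1.conj (phi C) (D.lDeltaTheta l) (γ ^ m) (rootLiftClass C))) -
        (h1Top C).symm (Additive.ofMul (ContH1.conj (phi C) (D.lDeltaTheta l) (γ ^ n) (rootLiftClass C)))) →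
      m = n)
    {i₀ : Iota}
    (hi₀ : iota i₀ = pairRhoLim C (inversionAlpha C ι hι) cι.thetaIso (thetaCompanion_phi C ι hι cι)
      (mem_lDeltaTheta_iff_thetaCompanion ι cι l) (mem_PiYdd_iff_of_piYddCharacteristic C hcharY _))
    {θ : ((thetaEnvData C hC hS hl hp2 hpl hζ mods f hf hmods h15 L hZ hcharY hlim).toRecord
          (h1LimConjMulAut (phi C) (D.lDeltaTheta l) (PiYdd C))
          (h1LimKummerOn (phi C) (D.lDeltaTheta l) (PiYdd C) c hA hfi O) iota).H}
    (hθ : θ ∈ ((thetaEnvData C hC hS hl hp2 hpl hζ mods f hf hmods h15 L hZ hcharY hlim).toRecord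
          (h1LimConjMulAut (phi C) (D.lDeltaTheta l) (PiYdd C))
          (h1LimKummerOn (phi C) (D.lDeltaTheta l) (PiYdd C) c hA hfi O) iota).thetaEnv i₀) :
    ∀ θ' ∈ ((thetaEnvData C hC hS hl hp2 hpl hζ mods f hf hmods h15 L hZ hcharY hlim).toRecord
          (h1LimConjMulAut (phi C) (D.lDeltaTheta l) (PiYdd C))
          (h1LimKummerOn (phi C) (D.lDeltaTheta l) (PiYdd C) c hA hfi O) iota).thetaEnv i₀,
      ∃ u ∈ ((thetaEnvData C hC hS hl hp2 hpl hζ mods f hf hmods h15 L hZ hcharY hlim).toRecord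
          (h1LimConjMulAut (phi C) (D.lDeltaTheta l) (PiYdd C))
          (h1LimKummerOn (phi C) (D.lDeltaTheta l) (PiYdd C) c hA hfi O) iota).units, θ' = u * θ :=
  horb_toRecord_pairRhoLim C hC hS hl hp2 hpl hζ mods f hf hmods h15 L hZ hcharY hlim iota c hA hfi O hc hOtors
    (inversionAlpha C ι hι) cι.thetaIso (thetaCompanion_phi C ι hι cι) (mem_lDeltaTheta_iff_thetaCompanion ι cι l)
    (mem_PiYdd_iff_of_piYddCharacteristic C hcharY _) γ ε hγ hε₁ hε₂ (toLZ_inversionAlpha_generator C ι hι γ hγ hZι)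
    hsign hroot hfree (hker_coh_of_fixed C (hfix_of_cyclotomeTower C hO τc)) hi₀ hθ

/-- **Print's root condition `hroots` AT THE GENUINE RECORD FROM THE [EtTh] INVERSION DATUM** ([IUTchII] Prop 1.4 p. 27 / Cor 3.5 (ii)
p. 95, `∞`-level): for ANY inversion family `iota` with `iota i₀ =` the limit action of `ι`, every `ϑ ∈ ∞θ^{i₀}_env(𝕄_*)` has a
positive power in `M^×_TM · θ^ℕ` — file 3's `hroots_toRecord_pairRhoLim` with (R1) := the [EtTh] datum and `hker` := the cyclotome
tower. [cite: Mochizuki2012, Cor 3.5 (ii) p.95] -/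
theorem hroots_toRecord_inversion (hc : Function.Bijective c.hom)
    (hOtors : ∀ a : A, IsOfFinOrder a → a ∈ O ∧ a⁻¹ ∈ O)
    (hsign : ∃ κ : ContH1 (phi C) (D.lDeltaTheta l) (PiYdd C ⊓ ⊤), κ ^ 2 = 1 ∧
      ContH1.conj (phi C) (D.lDeltaTheta l) ε (rootLiftClass C) = rootLiftClass C * κ)
    (hroot : ∃ τ₀ : Pi C, (τ₀ : D.PiTemp) ∈ D.GtpY ∧
      inversionTransport C ι hι cι hcharY (rootLiftClass C) = ContH1.conj (phi C) (D.lDeltaTheta l) τ₀ (rootLiftClass C))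
    (hfree : ∀ m n : ℤ, IsOfFinAddOrder
      ((h1Top C).symm (Additive.ofMul (ContH1.conj (phi C) (D.lDeltaTheta l) (γ ^ m) (rootLiftClass C))) -
        (h1Top C).symm (Additive.ofMul (ContH1.conj (phi C) (D.lDeltaTheta l) (γ ^ n) (rootLiftClass C)))) →
      m = n)
    {i₀ : Iota}
    (hi₀ : iota i₀ = pairRhoLim C (inversionAlpha C ι hι) cι.thetaIso (thetaCompanion_phi C ι hι cι)
      (mem_lDeltaTheta_iff_thetaCompanion ι cι l) (mem_PiYdd_iff_of_piYddCharacteristic C hcharY _))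
    {θ : ((thetaEnvData C hC hS hl hp2 hpl hζ mods f hf hmods h15 L hZ hcharY hlim).toRecord
          (h1LimConjMulAut (phi C) (D.lDeltaTheta l) (PiYdd C))
          (h1LimKummerOn (phi C) (D.lDeltaTheta l) (PiYdd C) c hA hfi O) iota).H}
    (hθ : θ ∈ ((thetaEnvData C hC hS hl hp2 hpl hζ mods f hf hmods h15 L hZ hcharY hlim).toRecord
          (h1LimConjMulAut (phi C) (D.lDeltaTheta l) (PiYdd C))
          (h1LimKummerOn (phi C) (D.lDeltaTheta l) (PiYdd C) c hA hfi O) iota).thetaEnv i₀) :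
    ∀ ϑ ∈ ((thetaEnvData C hC hS hl hp2 hpl hζ mods f hf hmods h15 L hZ hcharY hlim).toRecord
          (h1LimConjMulAut (phi C) (D.lDeltaTheta l) (PiYdd C))
          (h1LimKummerOn (phi C) (D.lDeltaTheta l) (PiYdd C) c hA hfi O) iota).inftyThetaEnv i₀,
      ∃ N : ℕ, 0 < N ∧ ϑ ^ N ∈ splitMonoid ((thetaEnvData C hC hS hl hp2 hpl hζ mods f hf hmods h15 L hZ hcharY hlim).toRecord
          (h1LimConjMulAut (phi C) (D.lDeltaTheta l) (PiYdd C))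
          (h1LimKummerOn (phi C) (D.lDeltaTheta l) (PiYdd C) c hA hfi O) iota).units (Submonoid.powers θ) :=
  hroots_toRecord_pairRhoLim C hC hS hl hp2 hpl hζ mods f hf hmods h15 L hZ hcharY hlim c hA hfi O iota hc hOtors
    (inversionAlpha C ι hι) cι.thetaIso (thetaCompanion_phi C ι hι cι) (mem_lDeltaTheta_iff_thetaCompanion ι cι l)
    (mem_PiYdd_iff_of_piYddCharacteristic C hcharY _) γ ε hγ hε₁ hε₂ (toLZ_inversionAlpha_generator C ι hι γ hγ hZι)
    hsign hroot hfree (hker_coh_of_fixed C (hfix_of_cyclotomeTower C hO τc)) hi₀ hθ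

end AnyConstants

end EtaleLevels

end Literature.IUT.HodgeArakelov

end
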